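import Mathlib
import Literature.MathematicalPhysics.QuantumLattice.WilsonDiracAP
import Literature.MathematicalPhysics.QuantumLattice.OverlapLocality
import Literature.Analysis.Toeplitz.WindingDecay

/-!
# Hadamard upper bound for the antiperiodic Wilson determinant
(helper for crux stmt-QuantumFields-9734, line `Sketch`, stub `stub_hadamardUpper`)

For every `U(3)` lattice gauge field `V` on the four-torus `(ℤ/Lℤ)⁴`, every bare mass `|m| ≤ 1`
and Wilson parameter `r = 1`, the determinant of the Wilson–Dirac matrix of the antiperiodically
sign-twisted field is at most `exp (12 log 9 · L⁴)`.  Proof: the `ℓ²` operator norm of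
`D_W = wilsonDirac ρ W m 1` is at most `|m + 4| + 4 ≤ 9` for ANY field `W` read through a unitary
representation `ρ` (`l2_opNorm_wilsonDirac_le`, Hernández–Jansen–Lüscher (2.14)); hence every
column `D_W e_k` has Euclidean norm `≤ 9` (`sum_norm_sq_mulVec_le`); Hadamard's inequality
(`Literature.Analysis.Toeplitz.norm_det_le_prod_norm_col`, after reindexing the
`12 L⁴`-element index type `TorusSite 4 L × Fin 3 × Fin 4` along `Fintype.equivFin`) gives
`‖det D_W‖ ≤ 9 ^ (12 L⁴) = exp (12 log 9 · L⁴)`.  The sign-twisted field is again a `U(3)` field,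
so the bound specialises to it.  No new definitions.
-/

noncomputable section

open scoped BigOperators Classical Matrix ComplexConjugate
open Finset
open Literature.MathematicalPhysics.QuantumLattice Literature.MathematicalPhysics.QuantumFieldTheory
  Literature.Probability.LatticeModels

namespace Summit.QuantumFields.QCD.Cruxes.CriticalLineDiamagnetism.ChessboardCellGain

/-- **Hadamard with a uniform column bound**: if every column of a complex square matrix `M` on a
finite index type `ι` has Euclidean norm at most `B ≥ 0`, then `‖det M‖ ≤ B ^ |ι|`
(Hadamard's inequality `Literature.Analysis.Toeplitz.norm_det_le_prod_norm_col` transported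
along `Fintype.equivFin ι` by `Matrix.det_reindex_self`). -/
theorem norm_det_le_pow_card_of_col_le {ι : Type*} [Fintype ι] [DecidableEq ι]
    (M : Matrix ι ι ℂ) {B : ℝ} (hB : 0 ≤ B) (hcol : ∀ k, ∑ j, ‖M j k‖ ^ 2 ≤ B ^ 2) :
    ‖M.det‖ ≤ B ^ Fintype.card ι := by
  set e := Fintype.equivFin ι
  rw [← Matrix.det_reindex_self e M]
  refine (Literature.Analysis.Toeplitz.norm_det_le_prod_norm_col _).trans ?_
  calc ∏ k, Real.sqrt (∑ j, ‖Matrix.reindex e e M j k‖ ^ 2)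
      ≤ ∏ _k : Fin (Fintype.card ι), B :=
        Finset.prod_le_prod (fun k _ => Real.sqrt_nonneg _) fun k _ => by
          rw [Real.sqrt_le_left hB]
          have hsum : ∑ j, ‖Matrix.reindex e e M j k‖ ^ 2 = ∑ i, ‖M i (e.symm k)‖ ^ 2 := by
            simp only [Matrix.reindex_apply, Matrix.submatrix_apply]
            exact e.symm.sum_comp (fun i => ‖M i (e.symm k)‖ ^ 2)
          rw [hsum]
          exact hcol _
    _ = B ^ Fintype.card ι := by simp

open scoped Matrix.Norms.L2Operator in
/-- **Column bound for the Wilson–Dirac matrix**: for a unitary representation `ρ`, any gauge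
field `U` on `(ℤ/Lℤ)⁴`, `r = 1` and `|m| ≤ 1`, every column of `wilsonDirac ρ U m 1` has squared
Euclidean norm at most `9 ^ 2` — the column is `D_W e_k`, and `‖D_W‖ ≤ |m + 4| + 4 ≤ 9` in the
`ℓ²` operator norm (Hernández–Jansen–Lüscher (2.14), `l2_opNorm_wilsonDirac_le`). -/
theorem sum_norm_sq_wilsonDirac_col_le {L N : ℕ} [NeZero L] {G : Type*} [Group G]
    (ρ : G →* Matrix (Fin N) (Fin N) ℂ) (hρ : ∀ g, ρ g ∈ Matrix.unitaryGroup (Fin N) ℂ)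
    (U : GaugeConfig 4 L G) {m : ℝ} (hm : |m| ≤ 1) (k : TorusSite 4 L × Fin N × Fin 4) :
    ∑ j, ‖wilsonDirac ρ U m 1 j k‖ ^ 2 ≤ 9 ^ 2 := by
  set D := wilsonDirac ρ U m 1 with hD
  have hnorm : ‖D‖ ≤ 9 := by
    refine (l2_opNorm_wilsonDirac_le ρ hρ U m).trans ?_
    obtain ⟨h₁, h₂⟩ := abs_le.mp hm
    rw [abs_of_nonneg (by linarith)]
    linarith
  have h := sum_norm_sq_mulVec_le D (Pi.single k 1)
  have h1 : ∑ i, ‖(Pi.single k (1 : ℂ) : TorusSite 4 L × Fin N × Fin 4 → ℂ) i‖ ^ 2 = 1 := by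
    rw [Finset.sum_eq_single k (fun i _ hi => by simp [hi]) (by simp)]
    simp
  rw [Matrix.mulVec_single_one, h1, mul_one] at h
  simp only [Matrix.col_apply] at h
  exact h.trans (pow_le_pow_left₀ (norm_nonneg _) hnorm 2)

/-- **Crude determinant bound for any `U(N)`-type field**: for a unitary representation `ρ` on
`ℂ^N`, any gauge field `U` on `(ℤ/Lℤ)⁴`, `r = 1` and `|m| ≤ 1`,
`‖det (wilsonDirac ρ U m 1)‖ ≤ 9 ^ (4 N L⁴)` (Hadamard + the column bound; the index type
`TorusSite 4 L × Fin N × Fin 4` has `L⁴ · N · 4` elements). -/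
theorem norm_det_wilsonDirac_le_pow {L N : ℕ} [NeZero L] {G : Type*} [Group G]
    (ρ : G →* Matrix (Fin N) (Fin N) ℂ) (hρ : ∀ g, ρ g ∈ Matrix.unitaryGroup (Fin N) ℂ)
    (U : GaugeConfig 4 L G) {m : ℝ} (hm : |m| ≤ 1) :
    ‖(wilsonDirac ρ U m 1).det‖ ≤ 9 ^ Fintype.card (TorusSite 4 L × Fin N × Fin 4) :=
  norm_det_le_pow_card_of_col_le _ (by norm_num) (sum_norm_sq_wilsonDirac_col_le ρ hρ U hm)

/-- **Stub `hadamardUpper` of line `Sketch` (crux stmt-QuantumFields-9734).** There is `h`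
(namely `h = 12 log 9`) such that for every `L ≥ 1`, every `U(3)` gauge field `V` on `(ℤ/Lℤ)⁴` and
every `|m| ≤ 1`, the determinant of the `r = 1` Wilson–Dirac matrix of the antiperiodically
sign-twisted field `e ↦ if (e.1 e.2).val + 1 = L then -V e else V e` (again a `U(3)` field) has
norm at most `exp (h L⁴)`: Hadamard's inequality with the `ℓ²` column bound `9` on the
`12 L⁴` columns. -/
theorem stub_hadamardUpper :
    ∃ h : ℝ, ∀ (L : ℕ) [NeZero L],
    let dAP : GaugeConfig 4 L (Matrix.unitaryGroup (Fin 3) ℂ) → ℝ → ℂ := fun V m =>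
      (wilsonDirac (unitaryFundamentalRep (Fin 3) ℂ)
        (fun e => if (e.1 e.2).val + 1 = L then -V e else V e) m 1).det;
    ∀ (V : GaugeConfig 4 L (Matrix.unitaryGroup (Fin 3) ℂ)) (m : ℝ), |m| ≤ 1 →
      ‖dAP V m‖ ≤ Real.exp (h * (L : ℝ) ^ 4) := by
  refine ⟨12 * Real.log 9, fun L _ => ?_⟩
  dsimp only
  intro V m hm
  refine (norm_det_wilsonDirac_le_pow (unitaryFundamentalRep (Fin 3) ℂ)
    unitaryFundamentalRep_mem_unitaryGroup _ hm).trans (le_of_eq ?_)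
  have hcard : Fintype.card (TorusSite 4 L × Fin 3 × Fin 4) = 12 * L ^ 4 := by
    simp only [Fintype.card_prod, Fintype.card_fun, ZMod.card, Fintype.card_fin]
    ring
  rw [hcard]
  calc (9 : ℝ) ^ (12 * L ^ 4) = Real.exp (Real.log 9) ^ (12 * L ^ 4) := by
        rw [Real.exp_log (by norm_num)]
    _ = Real.exp (((12 * L ^ 4 : ℕ) : ℝ) * Real.log 9) := (Real.exp_nat_mul _ _).symm
    _ = Real.exp (12 * Real.log 9 * (L : ℝ) ^ 4) := by
        congr 1
        push_cast
        ring

end Summit.QuantumFields.QCD.Cruxes.CriticalLineDiamagnetism.ChessboardCellGain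

end
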